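import Summits.CriticalPhenomena.CardyFormulaZ2.Theorems.CardyMagicRigidityNestingRigidityNeckFourArmInputsT
import HarnessLib

/-!
# Stub S11: node events over disjoint annuli of `𝕋` multiply, and each costs `(r/R)^{1+ε}` given (I4T)

Crux `Summit.CriticalPhenomena.CardyFormulaZ2.Theses.CardyMagicRigidity.NestingRigidity` (stmt-CriticalPhenomena-4835),
line `pinch-resampling` v4, stub S11 `stub_neckHookupCoarseT : NeckHookupCoarseT`.  The site-`𝕋` twin of
`…NeckZ2NodeProduct` (stub S12): the probabilistic primitive consumed by the multi-scale summation of the node events of the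
covering lemmas `covering_A_nodes` / `covering_B_nodes` (S11 road map, item 2: "product over hierarchy nodes by independence
of events determined by disjoint annuli"):

* `NeckCoarse.determinedBy_biInter_tFourArmTwoClusters`, `NeckCoarse.real_biInter_tFourArmTwoClusters_eq_prod`: the
  cluster-form four-arm events `TFourArmTwoClusters (w i) (r i) (R i)` around pairwise DISJOINT hexagonal annuli
  `{r i ≤ |· - w i|_𝕋 ≤ R i}` are jointly independent under `P_{1/2}` (induction on the family with the
  two-block independence `measureReal_inter_of_determinedBy_compl`);
* `real_biInter_tFourArmTwoClusters_le_prod_rpow` (anchor): hence, GIVEN the two-radius bound (I4T)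
  `FourArmTwoClustersBoundT` (conditional on `SmirnovWerner2001_fourArm_scalingLimit` by `…NeckFourArmBoundT`), their joint
  probability is at most `∏ C (r_i / R_i)^{1+ε}`.  Unlike the bond-`ℤ²` twin (Garban's bound is proved there) this is
  CONDITIONAL on (I4T), taken as a hypothesis.
-/

noncomputable section

namespace Summit.CriticalPhenomena.CardyFormulaZ2.Cruxes.NestingRigidity.PinchResampling

open MeasureTheory Set Literature.Probability.Percolation Literature.Probability.LatticeModels

namespace NeckCoarse

/-- A finite intersection of four-arm events reads only the union of their annuli. -/
theorem determinedBy_biInter_tFourArmTwoClusters {ι : Type*} (t : Finset ι) (w : ι → Site 2) (r R : ι → ℕ) :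
    DeterminedBy (⋂ i ∈ t, TFourArmTwoClusters (w i) (r i) (R i)) (⋃ i ∈ t, {y : Site 2 | (r i : ℤ) ≤ triNorm (y - w i) ∧ triNorm (y - w i) ≤ R i}) := by
  refine DeterminedBy.iInter fun i ↦ DeterminedBy.iInter fun hi ↦ (determinedBy_tFourArmTwoClusters (w i) (r i) (R i)).mono ?_
  intro y hy
  exact mem_biUnion hi hy

/-- A finite intersection of four-arm events is measurable. -/
theorem measurableSet_biInter_tFourArmTwoClusters {ι : Type*} (t : Finset ι) (w : ι → Site 2) (r R : ι → ℕ) :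
    MeasurableSet (⋂ i ∈ t, TFourArmTwoClusters (w i) (r i) (R i)) :=
  Finset.measurableSet_biInter t fun i _ ↦ measurableSet_tFourArmTwoClusters (w i) (r i) (R i)

/-- **Four-arm events around pairwise disjoint hexagonal annuli are jointly independent under `P_{1/2}`.** -/
theorem real_biInter_tFourArmTwoClusters_eq_prod {ι : Type*} (t : Finset ι) (w : ι → Site 2) (r R : ι → ℕ)
    (hdisj : (↑t : Set ι).PairwiseDisjoint fun i ↦ {y : Site 2 | (r i : ℤ) ≤ triNorm (y - w i) ∧ triNorm (y - w i) ≤ R i}) :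
    (triSitePercolation half).real (⋂ i ∈ t, TFourArmTwoClusters (w i) (r i) (R i)) =
      ∏ i ∈ t, (triSitePercolation half).real (TFourArmTwoClusters (w i) (r i) (R i)) := by
  classical
  induction t using Finset.induction_on with
  | empty => simp
  | @insert a t ha ih =>
    have hdisj' : (↑t : Set ι).PairwiseDisjoint fun i ↦ {y : Site 2 | (r i : ℤ) ≤ triNorm (y - w i) ∧ triNorm (y - w i) ≤ R i} :=
      hdisj.subset (by simp)
    rw [Finset.prod_insert ha, Finset.set_biInter_insert, ← ih hdisj']
    refine measureReal_inter_of_determinedBy_compl (measurableSet_tFourArmTwoClusters _ _ _)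
      (measurableSet_biInter_tFourArmTwoClusters t w r R) (determinedBy_tFourArmTwoClusters _ _ _)
      ((determinedBy_biInter_tFourArmTwoClusters t w r R).mono ?_)
    intro y hy hya
    simp only [mem_iUnion, exists_prop] at hy
    obtain ⟨i, hi, hyi⟩ := hy
    have hne : a ≠ i := fun h ↦ ha (h ▸ hi)
    exact Set.disjoint_left.1 (hdisj (Finset.mem_insert_self a t) (Finset.mem_insert_of_mem hi) hne) hya hyi

end NeckCoarse

/-- **Node events over disjoint annuli cost the product of the two-radius four-arm bounds, given (I4T).**  If
`FourArmTwoClustersBoundT` holds, there are `C` and `ε > 0` such that for every finite family of pairwise disjoint hexagonal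
annuli `{r i ≤ |· - w i|_𝕋 ≤ R i}` with `1 ≤ r i ≤ R i`, the `P_{1/2}`-probability that every annulus carries the
cluster-form four-arm event is at most `∏ C (r i / R i)^{1+ε}`. -/
theorem real_biInter_tFourArmTwoClusters_le_prod_rpow : FourArmTwoClustersBoundT → ∃ C ε : ℝ, 0 < ε ∧ ∀ (ι : Type) (t : Finset ι) (w : ι → Site 2) (r R : ι → ℕ), (∀ i ∈ t, 1 ≤ r i ∧ r i ≤ R i) → (↑t : Set ι).PairwiseDisjoint (fun i ↦ {y : Site 2 | (r i : ℤ) ≤ triNorm (y - w i) ∧ triNorm (y - w i) ≤ R i}) → (triSitePercolation half).real (⋂ i ∈ t, TFourArmTwoClusters (w i) (r i) (R i)) ≤ ∏ i ∈ t, C * ((r i : ℝ) / R i) ^ (1 + ε) := by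
  rintro ⟨ε, C, hε, h4⟩
  refine ⟨C, ε, hε, fun ι t w r R hrR hdisj ↦ ?_⟩
  rw [NeckCoarse.real_biInter_tFourArmTwoClusters_eq_prod t w r R hdisj]
  exact Finset.prod_le_prod (fun i _ ↦ measureReal_nonneg) fun i hi ↦ h4 (w i) (r i) (R i) (hrR i hi).1 (hrR i hi).2

end Summit.CriticalPhenomena.CardyFormulaZ2.Cruxes.NestingRigidity.PinchResampling

end
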